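import Mathlib
import HarnessLib
import HarnessLib.Audit
import Summits.AtomisticToContinuum.Statement
import Literature.Geometry.DiscreteGeometry.TwoShellPatterns
import Literature.MathematicalPhysics.StatisticalMechanics.BarlowStacking
import Literature.MathematicalPhysics.StatisticalMechanics.LennardJonesClusters
import Summits.AtomisticToContinuum.Crystallization.Theorems.ReggeStarCoercivityDefectFreeCrystallizesHullCriterion
import Summits.AtomisticToContinuum.Crystallization.Theorems.ExcessDecayLiouvilleCrysEnergyLimit
import Summits.AtomisticToContinuum.Crystallization.Theorems.PhononSlackCertificatesWindowOptimality
import HarnessLib.Audit.Status.Attr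

/-!
Route: NashClassCertificates

DORMANT since 2026-08-26T08:26:19Z (reconciler: no traction for 8.4 d (last activity item-evidence-added at 2026-08-17T22:14:47Z); parked, not closed — `ledger route dormant route-AtomisticToContinuum-NashClassCertificates --off` to rea) — unstaffed, not closed; items shared with open routes are served there. `ledger route dormant <id> --off` reactivates.

# Route NashClassCertificates — price only Nash-stable frustration — ground states are Nash
equilibria of the site-selection game, so two-shell certificates need hold only on the Nash class

A finite configuration x is NASH (for V_LJ) when no single particle can lower the energy by
relocating anywhere: for every i and every free point y, siteEnergy(x,i) = Σ_{j≠i} V(|x_i−x_j|) ≤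
Σ_{j≠i} V(|y−x_j|) — x is a pure Nash equilibrium of the N-player site-selection game whose exact
potential is the energy (Monderer–Shapley), so every ground state is Nash (support
GroundStatesAreNash, proved in the planner's Sketch.lean), and Nash points are in particular
force-balanced, single-site stable (on-site Hessian PSD) and obey the Aufbau inequality max_i
siteEnergy ≤ inf_y (hole potential). It suffices to show X = X₁ ∧ X₂ ON THE NASH CLASS ONLY: X₁ =
NashTwoShellGap — every 1/3-separated Nash configuration of N points in ℝ³ has 𝓔_LJ(x) ≥ N·e* +
g·#{1/20-bad particles} (e* = ⨅ periodic e; bad = not IsTwoShellGood (1/20) (47/50) 1, the landed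
predicate); X₂ = NashNearField — on 1/20-good regions of 1/3-separated Nash configurations the
excess Σ(e_i − e*) is coercive in the count of radius-2 balls not η-matched to the layered family,
up to a radius-4 boundary charge. Both are the two live cruxes of the hub (CoerciveTwoShellGap 13956
/ NearFieldConvexity 13958, quantified there over ALL δ-separated configurations) restricted to the
variety cut out by the minimiser's own optimality conditions; the rest of the assembly is the PROVED
layered-hull infrastructure (HullBridge ported as NashHullBridge; PeriodicGivenLayered 11779 kept as
a hypothesis; WindowOptimality 13962, HullCriterion 3243 and CrysEnergyLimit 0626 enter the deciding
theorem as PROVED tree theorems).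
Lean: `NashTwoShellGap ∧ NashNearField`

## Assembly
Pure logic over the items plus four PROVED tree theorems used inside the proof (no extra
hypothesis): LennardJonesGroundStatesExist_holds, PrestressSplitKorn.stub_hullCriterion
(HullCriterion 3243), windowOptimality_proof (WindowOptimality 13962; rev 3 — formerly the open twin
item 16829) and crysEnergyLimit_proof (CrysEnergyLimit 0626). closes (NashTwoShellGap)
(NashNearField) (NashHullBridge) (PeriodicGivenLayered): LayeredWindows := NashHullBridge _ _;
PeriodicWindows := PeriodicGivenLayered ∘ LayeredWindows; (ii) := HullCriterion PeriodicWindows;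
pick ground states x (proved fact), P from PeriodicWindows x, IsLeast from windowOptimality_proof, ⨅
= e(P) by IsLeast.csInf_eq, Tendsto from CrysEnergyLimit; ⟨⟨P, IsLeast, Tendsto⟩, (ii)⟩ :
_root_.Crystallization — checked rc 0, sorry-free, axioms {propext, Classical.choice, Quot.sound}
(planner Sketch.lean closes4 / glue.lean; same proof shape as route PhononSlackCertificates' closes,
by design: only the two certificate cruxes differ).

Rationale: WHY THIS LINE. Mechanism (imported from polynomial optimisation and game theory, with the
dictionary: polynomial f ↦ LJ energy on a window; gradient/KKT ideal ↦ per-particle force balance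
F_i = 0, on-site Hessian H_i ⪰ 0 and the best-response inequalities siteEnergy(x,i) ≤ φ_{x∖i}(y);
SOS multiplier σ·∇f ↦ pattern-local multiplier fields μ_i·F_i, ⟨S_i,H_i⟩ with S_i ⪰ 0, and λ_i(dy) ≥
0 on relocations): Nie–Demmel–Sturmfels (NieDemmelSturmfels2005: when the minimum is attained, f −
f* is a sum of squares modulo the gradient ideal at FINITE degree — exactly so if the gradient ideal
is radical, up to ε otherwise — while unconstrained SOS/Putinar certificates may fail or need
unbounded degree) and Demmel–Nie–Powers (DemmelNiePowers2007, KKT ideals on non-compact sets) give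
the pedigree: certificates required to hold only on the critical variety exist where unconstrained
ones do not; the finite-range non-existence of m-potentials for frustrated systems (Miekisz, cited
by route FrustrationRangeCertificates) is exactly such a gap. Here the class is typed by ONE
inequality family — Nash stability under single-particle relocation (the one-particle move of
Xue1997/Blanc2004/BlancLewin2015 §2.2, used there only for minimal distance) — which implies all
first- and second-order single-site conditions and kills, before any LP is run, every recorded
refutation witness of certificate cruxes on this hub: dense δ-clouds and vacuum-gap walls
(FarFieldGap 13957: a compressed particle or an isolated bad particle next to a dense cloud
relocates to the free surface), isolated point defects (vacancies/interstitials/adatoms relocate —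
the levy obstruction "mild point-like defects" of NearFarGlueR 14970), incipient slip and optical
shuffles (not force-balanced — the near-field obstruction of 13958). What it does that the 40 open
routes do not: every energy-inequality route (PhononSlack, FrustrationRange, FreeSplitting,
ThreeCone, ReggeStar, PricedLink, SquareWellLayerCake, HcpDefectCounting, PRVariance, Perron, …)
quantifies its inequality over all (separated) configurations;
ExcessDecayLiouville/HolmgrenBoyleLind use force balance of LIMIT configurations for
regularity/unique continuation, not as certificate slack in the frustrated regime;
HcpTheta/VdwKissing use the one GLOBAL scaling multiplier (virial). Idea-pool precedent (declared,
not hidden): cards self-certifying-minimiser-kkt-cuts / born-stability-cuts proposed g₂-LINEAR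
virial/Born/Einstein cuts at the pair-LP level (graded new-combination; declined for lack of an
assembly and predicted inert because root-averaged pair statistics let a stable icosahedral glass
pass) — this route works at the pattern level with per-particle multipliers, adds the finite-move
(Nash/Aufbau) family, and carries its own deciding theorem.

RANKED CRUXES. #2 NashTwoShellGap (crux) — COERCIVE TWO-SHELL GAP ON THE NASH CLASS: there is g > 0
such that every 1/3-separated finite configuration x of ℝ³ that is Nash for V_LJ (no particle lowers
the energy by relocating to any free point) satisfies 𝓔_LJ(x) ≥ N·e* + g·#{i : ¬IsTwoShellGood
(1/20) (47/50) 1 x i}, e* = ⨅ over periodic Q of e(Q). Weaker than CoerciveTwoShellGap (stmt-13956: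
all δ-separated x, ∀δ) and still sufficient, because ground states are 1/3-separated
(third_le_dist_of_isGroundState) and Nash (GroundStatesAreNash). Intended proof: Nash-LIFTED
two-shell transfer certificates — site inequality e_i + (transfers) + μ_i·F_i − ⟨S_i,H_i⟩ −
∫(φ_{x∖i}(y) − φ_{x∖i}(x_i)) λ_i(dy) ≥ ē + g·1[bad] with pattern-local multiplier fields, found by
LP on decorated Hales fans and certified by interval arithmetic against a certified upper value ē ≥
e*; plus the (analytic) near field of NashNearField and a levy on the Nash class, where point-like
mild defects do not occur. [difficulty: XL] (why it might fail: A NASH competitor with a positive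
bad fraction within o(N) of N·e*: a tetrahedrally close-packed periodic LJ equilibrium
(A15/σ/approximant) or a stable icosahedral glass tied with hcp inside the certificate error, or
residually stressed good crystal just past the 1/20 tolerance at cost ~c/400.)
[NieDemmelSturmfels2005, DemmelNiePowers2007, MondererShapley1996, Xue1997, Blanc2004,
BlancLewin2015, HalesDSP2012, Hales2012, FlatleyTheil2015,
Literature.Barriers.AtomisticToContinuum.TetrahedralFrustration,
Literature.Barriers.AtomisticToContinuum.IcosahedralClusters]
#3 NashNearField (crux) — NEAR FIELD ON THE NASH CLASS: for every η > 0 there are c > 0 and C such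
that for every 1/3-separated Nash configuration x and every set Ω of 1/20-good particles,
Σ_{i∈Ω}(e_i − e*) ≥ c·#{i ∈ Ω : the radius-2 ball of x_i is not two-way η-matched, after a
translation, to a layered set (triangular layers of spacing a ∈ [47/50,1] in hole registry along a
Hägg word, free interlayer spacings in [39a/50, 17a/20])} − C·#{i ∈ Ω : some particle outside Ω lies
within 4 of x_i} (e_i the site energy ½Σ_{j≠i}V). NearFieldConvexity (stmt-13958) restricted to δ =
1/3 and to Nash configurations. Two intended proofs: (a) phonon/elastic convexity of the relaxed
layered family in co-rotated frames (E–Ming, FJM) as in 13958; (b) NEW on the Nash class: Nash ⇒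
force balance, so the displacement from the nearest layered set solves the linearised equilibrium
system up to quadratic errors and interior (discrete-harmonic) gradient estimates make good regions
locally affine — sub-quadratic incipient slip and optical shuffles, the recorded obstruction of
13958, are not equilibria. [difficulty: XL] (why it might fail: Needs uniform phonon+elastic
coercivity of every relaxed Barlow polytype on the box, even for equilibria: a force-balanced soft
shear branch, or a stressed good region held by bad matter at sub-quadratic cost in the non-matched
count, refutes it; radius-4 boundary may be short.) [EMing2006, FrieseckeJamesMuller2002, Theil2006,
AyalaChoksiWirth2025, LauteriLuckhaus2017, BlancLewin2015]
#4 PeriodicGivenLayered (crux) — PERIODIC GIVEN LAYERED (shared item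
stmt-AtomisticToContinuum-11779, PROVED in tree by Theorems.LayeredHull.PeriodicGivenLayered_of;
re-asked verbatim so the ledger attaches this route): for every sequence of LJ ground states,
layered windows at every scale imply periodic windows at every scale (one periodic P). Stacking
selection inside the hull; the only place stacking order enters. [difficulty: provable-now] (why it
might fail: Proved in tree (stmt-11779 closed); listed as a crux only because the deciding theorem
consumes it as a hypothesis; no residual risk beyond a tree revert.) [BlancLewin2015,
RadinSchulman1983, LoachAckland2017]
#9 NashHullBridge (crux) — BRIDGE ON THE NASH CLASS (port of the PROVED HullBridge stmt-15147 =
Theorems.HullBridgeExact.hullBridge_proof, whose proof applies its two antecedents to ground states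
only): NashTwoShellGap → NashNearField → every sequence of LJ ground states has layered windows at
every scale (LayeredWindows stmt-11778 unfolded verbatim). Port: ground states are 1/3-separated
(third_le_dist_of_isGroundState) and Nash (GroundStatesAreNash), E(N) ≤ N e* + o(N)
(crysEnergyLimit_proof) gives #bad = o(N), the near field at fixed η with Ω = good particles gives
#non-η-layered good = o(N), and the landed gluing lemma PrestressSplitKorn.stub_layeredGluing
integrates η-layered 2-balls on a margin ball exactly as in hullBridge_of_layeredGluing. [deps:
NashTwoShellGap, NashNearField] [difficulty: M] (why it might fail: Only bookkeeping of the port: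
the landed reduction hullBridge_of_layeredGluing is stated for the all-configuration antecedents;
re-running it needs the Nash property threaded through its ground-state instantiation, nothing
quantitative.) [BlancLewin2015, HalesDSP2012, FrieseckeJamesMuller2002]
(former #9 WindowOptimality — stmt-AtomisticToContinuum-16829, the text-identical open twin of the
PROVED shared item stmt-13962 — is no longer an item since rev 3 (route-repair, cone, gen 2):
`closes` discharges it by the tree theorem Theorems.windowOptimality_proof, imported from
Theorems.PhononSlackCertificatesWindowOptimality, whose module cone adds nothing beyond the
summit-statement baseline. PeriodicGivenLayered, the other proved twin (17658 ≡ 11779), stays a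
hypothesis on purpose: its proof module Theorems.PhononSlackCertificatesPeriodicGivenLayered drags
the declared-only NumberField.ExtendedRiemannHypothesis' of
Literature/NumberTheory/LFunctions/DedekindZeta.lean into the import cone; a prover closes 17658
with one `exact LayeredHull.PeriodicGivenLayered_of`.)
#9 GroundStatesAreNash (support) — GROUND STATES ARE NASH: for every LJ ground state x of N
particles in ℝ³, every i and every point y distinct from the other particles, siteEnergy(x,i) ≤
Σ_{j≠i} V_LJ(|y − x_j|). One-particle move (update x i y is injective, its energy is ≥ E(N) = 𝓔(x);
sum_siteEnergy_update_sub + two_mul_interactionEnergy). PROVED sorry-free in the planner's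
Sketch.lean (groundStatesAreNash_proof); to be landed by any prover with --supports. [difficulty:
provable-now] [BlancLewin2015, Xue1997, Blanc2004]
#9 LayeredWindows (support) — LAYERED WINDOWS (shared stmt-AtomisticToContinuum-11778, verbatim):
every sequence of LJ ground states has, at every scale and frequently in N, a window two-way
ε-matched with a rigid image of triangular layers in hole registry along a Hägg word with free
interlayer spacings. Conclusion of NashHullBridge; hypothesis of PeriodicGivenLayered. [difficulty:
XL] [HalesDSP2012, BlancLewin2015]
#9 PeriodicWindows (support) — PERIODIC WINDOWS (shared stmt-AtomisticToContinuum-3240, verbatim):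
one periodic P two-way ε-matched on every ball by translates of the ground states, frequently in N.
Derived in closes from LayeredWindows and PeriodicGivenLayered; turned into IsCrystallizing by the
PROVED hull criterion (PrestressSplitKorn.stub_hullCriterion, stmt-3243). [difficulty: L]
[BlancLewin2015]

TWO-LAYER PLAN. NashTwoShellGap ⇐ NashFarField → NashNearField → NashTwoShellGap (the far/near/levy
split of route PhononSlackCertificates, on the Nash class: NashFarField = FarFieldGapR 14969 at δ =
1/3 restricted to Nash x; the levy is where the Nash restriction bites — no isolated point defects),
filed only when a prover asks. NashNearField ⇐ NashHarmonicInterior (discrete-harmonic interior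
estimate for force-balanced near-layered windows) → PolytypePhononStability (certified Bloch
eigenvalues on the box, shareable with 13958/PhononStability 9333) → NashNearField.

KILL CRITERIA. refuted:NashTwoShellGap by an explicit 1/3-separated Nash family with a positive bad
fraction and 𝓔 ≤ N(e* + o(1)) closes the route outright (and refutes CoerciveTwoShellGap 13956 a
fortiori — shared negative knowledge). refuted:NashNearField forces a pivot to the harmonic-interior
variant (Two-layer plan) or to a weaker matched-count; if NearFieldConvexity 13958 is PROVED the
crux is moot (implied). If CoerciveTwoShellGap 13956 is proved the whole route is superseded by
PhononSlackCertificates (close superseded); conversely a proof here does NOT close 13956.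

NOT DECOMPOSED YET. The certificate level (two shells vs 2.5), the multiplier bounds, the certified
upper value ē for e(hcp(a*,h*)), the tail-as-pressure split beyond the certificate radius, the
separation bootstrap on the Nash class (expected ≥ 0.7 from siteEnergy ≤ 0 + shell counting,
replacing 1/3 inside proofs), and the far/near/levy split are all layer-2; nothing is filed until a
prover engages NashTwoShellGap.

CHEAPEST FALSIFIER. (1) kit, minutes: the one-centre and two-centre LP lower bounds for the LJ site
energy over 1/3-separated shells WITH vs WITHOUT the Nash cuts (force balance at the centre and
first shell, on-site Hessian PSD, best-response inequalities against the window's own holes): if the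
lifted values do not move, the lever is inert at low level and the route is only the trivial
weakening of 13956/13958 (it then survives but loses its why-easier); (2) lookup/certified lattice
sums: LJ energies of the tetrahedrally close-packed competitors (A15, σ, bcc, icosahedral
approximants; BeterminSamajTravenec2022 for the lattice part) against e(hcp) ≈ −0.7176 — any
non-layered periodic LJ EQUILIBRIUM within 10⁻³|e*| of hcp makes g incompatible with a two-shell
radius; (3) in-Lean: none cheap (the crux is an ∃-certificate); GroundStatesAreNash is already
checked rc 0.

NUMBERS. e* = ⨅ periodic e ≈ e(hcp(a*,h*)) ≈ −0.7176 in Blanc–Lewin units (V = r⁻¹²/12 − r⁻⁶/6), a*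
≈ 0.9712 (cards kkt-cuts / EnergyDerivativeOrder); hcp − fcc ≈ −7·10⁻⁵ per particle (stacking scale,
handled by the PROVED PeriodicGivenLayered, never by the certificates); bcc ≈ 4 % above fcc for LJ
(BeterminSamajTravenec2022); decahedral ring closure strain 0.0067
(Literature.Barriers.AtomisticToContinuum.DecahedralSoftShell); goodness tolerance 1/20, scale box
[47/50, 1], interlayer box [39a/50, 17a/20] (landed predicate IsTwoShellGood and LayeredWindows
11778); separation 1/3 (third_le_dist_of_isGroundState); kink level = e* (Kossel; the Aufbau pinning
of Nash clusters with a kink site).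

DEFINITION REQUESTS. Optional, after open: `IsNashConfiguration V x` in
Literature/MathematicalPhysics/StatisticalMechanics (the inlined best-response clause), with the
API: ground states are Nash; Nash ⇒ siteEnergy ≤ 0 (finite clusters), force balance, on-site Hessian
PSD, Aufbau max_i siteEnergy ≤ inf_y φ_{x∖i}(y).

Novelty: Searches (2026-08-17): lit search --hybrid "Nash equilibrium potential game particles pair
interaction lattice formation" (8 book hits, game theory only), "sum of squares gradient ideal
global optimality certificate Nie Demmel Sturmfels" (Blekherman–Parrilo–Thomas held), "single
particle moves stability ground state Lennard-Jones vacancy surface" (textbook defect physics only),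
"Lagrange multiplier first order conditions lower bound energy certificate crystal" (optimisation
textbooks only), "crystallization three dimensions ground state periodic"
(BeterminSamajTravenec2021/2022 lattice ground states); lit galaxy search "crystallization problem"
--star pdf (Kubin–Ponsiglione arXiv:2004.06820, Bétermin–Knüpfer); lit frontier AtomisticToContinuum
--since 2021 (30 rows, none on T = 0 certificates); remote OpenAlex/S2 rate-limited this session
(noted). In-hub: all 40 open route files (lever map in NOTES), the 17 negatives, 100 closed + 22
open idea cards — nearest: cards self-certifying-minimiser-kkt-cuts and born-stability-cuts
(g₂-linear virial/Born/Einstein cuts in the pair LP; new-combination; declined: no assembly,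
predicted inert at pair level), kossel-squeeze-surface-relations (N ↦ N±1 insertion/removal in
Cesàro form; variant).
Nearest prior art found: NieDemmelSturmfels2005 and DemmelNiePowers2007 (SOS modulo gradient/KKT
ideals — the certificate-existence pedigree); Xue1997 / Blanc2004 / BlancLewin2015 §2.2 (the
one-particle move, used for minimal distance only); Mondere  [refs: 2004.06820, BeterminSamajTravenec2021, NieDemmelSturmfels2005, DemmelNiePowers2007, Xue1997, Blanc2004, BlancLewin2015, MondererShapley1996]

Barriers (technique_class: nash-class restriction, kkt cuts, local certificates): - technique_class: nash-class restriction, kkt cuts, local certificates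
- Literature.Barriers.AtomisticToContinuum.TetrahedralFrustration: pure one-cell/one-centre bounds
are not sharp; the certificates here are multi-centre with zero-sum transfers AND are required only
on Nash patterns — the Rogers/regular-tetrahedron extremisers are not Nash-extendable at LJ bond
stiffness; the bet is that frustration pseudo-laws violating per-particle balance are what keeps
two-shell levels from closing.
- Literature.Barriers.AtomisticToContinuum.TetrahedralFrustrationNarrow: same — no raw single-cell,
volume-independent bound is used; admissible partitions with transfers (Lagarias's class) plus the
Nash restriction are exactly the named evasion.
- Literature.Barriers.AtomisticToContinuum.DecahedralSoftShell: no pattern-rigidity at 1 % is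
claimed; decahedral shells are Nash-compatible and are priced by energy (ring-closure strain ≥
0.0067 at every axis site), not excluded combinatorially.
- Literature.Barriers.AtomisticToContinuum.FlexibleKissingArrangements: not met — no single-shell
local-rigidity inference (twelve neighbours ⇒ fcc/hcp shell) is made; goodness is a TWO-shell metric
test and badness is priced, never inferred away.
- Literature.Barriers.AtomisticToContinuum.IcosahedralClusters: consistent — Mackay/anti-Mackay
clusters ARE Nash (they are ground states at N = 13, 55, …); NashTwoShellGap charges their (all-bad)
particles g each, which their O(N^(2/3)) surface plus strain exce

History (route lifecycle, newest last):
- 2026-08-17T01:06:29Z · rev 3: restated Assembly (stmt-AtomisticToContinuum-16831) — route-repair (cone, gen 2): (i) discharge WindowOptimality inside `closes` by the PROVED tree theorem Theorems.windowOptimality_proof (stmt-13962, text-identica (planner-rrepair-AtomisticToContinuum-NashClass-db305149-g2-0)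
- 2026-08-17T01:06:29Z · rev 3: dropped WindowOptimality — route-repair (cone, gen 2): (i) discharge WindowOptimality inside `closes` by the PROVED tree theorem Theorems.windowOptimality_proof (stmt-13962, text-identica (planner-rrepair-AtomisticToContinuum-NashClass-db305149-g2-0)
- 2026-08-26T08:26:19Z · DORMANT — reconciler: no traction for 8.4 d (last activity item-evidence-added at 2026-08-17T22:14:47Z); parked, not closed — `ledger route dormant route-AtomisticToConti (operator:999:350275)

sub-problem: Crystallization · status: dormant · opened planner-plan-novel-AtomisticToContinuum-Crystal-ad211d65-v2-g10-0 2026-08-17T00:30:15Z · rev 3 · ledger route-AtomisticToContinuum-NashClassCertificates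
GENERATED by the gate from the ledger (D-0016/17). Provers cite these decls: `theorem foo : Summit.AtomisticToContinuum.Crystallization.Theses.NashClassCertificates.<Decl> := …` in Summits/AtomisticToContinuum/Crystallization/Theorems/<Name>.lean.
-/

namespace Summit.AtomisticToContinuum.Crystallization.Theses.NashClassCertificates

open scoped BigOperators Topology Manifold Classical MeasureTheory ProbabilityTheory Matrix InnerProductSpace ComplexConjugate ContinuousMap
open Filter Set Function TopologicalSpace MeasureTheory

attribute [summit_statement] _root_.Crystallization

/-- item stmt-AtomisticToContinuum-16826 · crux · rank 2 · open · by planner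
why it might fail: A NASH competitor with a positive bad fraction within o(N) of N·e*: a tetrahedrally close-packed periodic LJ equilibrium (A15/σ/approximant) or a stable icosahedral glass tied with hcp inside the certificate error, or residually stressed good crystal just past the 1/20 tolerance at cost ~c/400.
sources: NieDemmelSturmfels2005, DemmelNiePowers2007, MondererShapley1996, Xue1997, Blanc2004, BlancLewin2015
[crux] COERCIVE TWO-SHELL GAP ON THE NASH CLASS: there is g > 0 such that every 1/3-separated finite
configuration x of ℝ³ that is Nash for V_LJ (no particle lowers the energy by relocating to any free
point) satisfies 𝓔_LJ(x) ≥ N·e* + g·#{i : ¬IsTwoShellGood (1/20) (47/50) 1 x i}, e* = ⨅ over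
periodic Q of e(Q). Weaker than CoerciveTwoShellGap (stmt-13956: all δ-separated x, ∀δ) and still
sufficient, because ground states are 1/3-separated (third_le_dist_of_isGroundState) and Nash
(GroundStatesAreNash). Intended proof: Nash-LIFTED two-shell transfer certificates — site inequality
e_i + (transfers) + μ_i·F_i − ⟨S_i,H_i⟩ − ∫(φ_{x∖i}(y) − φ_{x∖i}(x_i)) λ_i(dy) ≥ ē + g·1[bad] with
pattern-local multiplier fields, found by LP on decorated Hales fans and certified by interval
arithmetic against a certified upper value ē ≥ e*; plus the (analytic) near field of NashNearField
and a levy on the Nash class, where point-like mild defects do not occur. [difficulty: XL] -/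
@[route_item "route-AtomisticToContinuum-NashClassCertificates", crux]
def NashTwoShellGap : Prop :=
  ∃ g : ℝ, 0 < g ∧ ∀ (N : ℕ) (x : Fin N → EuclideanSpace ℝ (Fin 3)), (∀ i j : Fin N, i ≠ j → 1 / 3 ≤ dist (x i) (x j)) → (∀ (i : Fin N) (y : EuclideanSpace ℝ (Fin 3)), (∀ j : Fin N, j ≠ i → y ≠ x j) → Literature.MathematicalPhysics.StatisticalMechanics.siteEnergy Literature.MathematicalPhysics.StatisticalMechanics.lennardJones x i ≤ ∑ j ∈ Finset.univ.erase i, Literature.MathematicalPhysics.StatisticalMechanics.lennardJones (dist y (x j))) → (N : ℝ) * (⨅ Q : Literature.MathematicalPhysics.StatisticalMechanics.PeriodicConfiguration 3, Q.energyPerParticle Literature.MathematicalPhysics.StatisticalMechanics.lennardJones) + g * (Nat.card {i : Fin N // ¬ Literature.Geometry.DiscreteGeometry.IsTwoShellGood (1 / 20) (47 / 50) 1 x i} : ℝ) ≤ Literature.MathematicalPhysics.StatisticalMechanics.interactionEnergy Literature.MathematicalPhysics.StatisticalMechanics.lennardJones x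

/-- item stmt-AtomisticToContinuum-16827 · crux · rank 3 · open · by planner
why it might fail: Needs uniform phonon+elastic coercivity of every relaxed Barlow polytype on the box, even for equilibria: a force-balanced soft shear branch, or a stressed good region held by bad matter at sub-quadratic cost in the non-matched count, refutes it; radius-4 boundary may be short.
sources: EMing2006, FrieseckeJamesMuller2002, Theil2006, AyalaChoksiWirth2025, LauteriLuckhaus2017, BlancLewin2015
[crux] NEAR FIELD ON THE NASH CLASS: for every η > 0 there are c > 0 and C such that for every
1/3-separated Nash configuration x and every set Ω of 1/20-good particles, Σ_{i∈Ω}(e_i − e*) ≥ c·#{i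
∈ Ω : the radius-2 ball of x_i is not two-way η-matched, after a translation, to a layered set
(triangular layers of spacing a ∈ [47/50,1] in hole registry along a Hägg word, free interlayer
spacings in [39a/50, 17a/20])} − C·#{i ∈ Ω : some particle outside Ω lies within 4 of x_i} (e_i the
site energy ½Σ_{j≠i}V). NearFieldConvexity (stmt-13958) restricted to δ = 1/3 and to Nash
configurations. Two intended proofs: (a) phonon/elastic convexity of the relaxed layered family in
co-rotated frames (E–Ming, FJM) as in 13958; (b) NEW on the Nash class: Nash ⇒ force balance, so the
displacement from the nearest layered set solves the linearised equilibrium system up to quadratic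
errors and interior (discrete-harmonic) gradient estimates make good regions locally affine —
sub-quadratic incipient slip and optical shuffles, the recorded obstruction of 13958, are not
equilibria. [difficulty: XL] -/
@[route_item "route-AtomisticToContinuum-NashClassCertificates", crux]
def NashNearField : Prop :=
  ∀ η : ℝ, 0 < η → ∃ c : ℝ, 0 < c ∧ ∃ C : ℝ, ∀ (N : ℕ) (x : Fin N → EuclideanSpace ℝ (Fin 3)), (∀ i j : Fin N, i ≠ j → 1 / 3 ≤ dist (x i) (x j)) → (∀ (i : Fin N) (y : EuclideanSpace ℝ (Fin 3)), (∀ j : Fin N, j ≠ i → y ≠ x j) → Literature.MathematicalPhysics.StatisticalMechanics.siteEnergy Literature.MathematicalPhysics.StatisticalMechanics.lennardJones x i ≤ ∑ j ∈ Finset.univ.erase i, Literature.MathematicalPhysics.StatisticalMechanics.lennardJones (dist y (x j))) → ∀ Ω : Finset (Fin N), (∀ i ∈ Ω, Literature.Geometry.DiscreteGeometry.IsTwoShellGood (1 / 20) (47 / 50) 1 x i) → c * (Nat.card {i : Fin N // i ∈ Ω ∧ ¬ (∃ (A : EuclideanSpace ℝ (Fin 3) →ₗᵢ[ℝ] EuclideanSpace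 ℝ (Fin 3)) (t : EuclideanSpace ℝ (Fin 3)) (a : ℝ) (s : ℤ → ℤ) (z : ℤ → ℝ), 47 / 50 ≤ a ∧ a ≤ 1 ∧ Literature.MathematicalPhysics.StatisticalMechanics.IsHaggSeq s ∧ (∀ m : ℤ, 39 / 50 * a ≤ z (m + 1) - z m ∧ z (m + 1) - z m ≤ 17 / 20 * a) ∧ let S : Set (EuclideanSpace ℝ (Fin 3)) := {p | ∃ m i j : ℤ, p = A (((i : ℝ) • Literature.MathematicalPhysics.StatisticalMechanics.triangularVec₁ a) + ((j : ℝ) • Literature.MathematicalPhysics.StatisticalMechanics.triangularVec₂ a) + ((Literature.MathematicalPhysics.StatisticalMechanics.haggLabel s m : ℝ) • Literature.MathematicalPhysics.StatisticalMechanics.barlowOffset a) + (z m • Literature.MathematicalPhysics.StatisticalMechanics.layerNormal 1))}; (∀ j : Fin N, dist (x j) (x i) ≤ 2 → ∃ p ∈ S, dist (x j + t) p ≤ η) ∧ (∀ p ∈ S, dist p (x i + t) ≤ 2 → ∃ j : Fin N, dist (x j + t) p ≤ η))} : ℝ) - C * (Nat.card {i : Fin N // i ∈ Ω ∧ ∃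 j : Fin N, j ∉ Ω ∧ dist (x j) (x i) ≤ 4} : ℝ) ≤ ∑ i ∈ Ω, ((1 / 2 : ℝ) * (∑ j ∈ Finset.univ.erase i, Literature.MathematicalPhysics.StatisticalMechanics.lennardJones (dist (x i) (x j))) - (⨅ Q : Literature.MathematicalPhysics.StatisticalMechanics.PeriodicConfiguration 3, Q.energyPerParticle Literature.MathematicalPhysics.StatisticalMechanics.lennardJones))

/-- item stmt-AtomisticToContinuum-17658 · crux · rank 4 · closed · proved by Summit.AtomisticToContinuum.Crystallization.Theorems.NashPeriodicGivenLayered.periodicGivenLayered_proof @ 61c8b112ea51 (prover) · by planner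
why it might fail: Proved in tree (stmt-11779 closed); listed as a crux only because the deciding theorem consumes it as a hypothesis; no residual risk beyond a tree revert.
sources: BlancLewin2015, RadinSchulman1983, LoachAckland2017
[support] PERIODIC GIVEN LAYERED — the shared item stmt-AtomisticToContinuum-11779 (verbatim
signature; PROVED 2026-08-16 by
Summit.AtomisticToContinuum.Crystallization.Theorems.LayeredHull.PeriodicGivenLayered_of): for every
sequence of LJ ground states, layered windows at every scale (LayeredWindows format) imply periodic
windows at every scale. Attached here (route-repair/cone) so that `closes` takes it as hypothesis h3
instead of importing its proof module, whose import closure carries the declared-only ERH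
conjectures of Literature/NumberTheory/LFunctions/DedekindZeta.lean. [difficulty: proved]
[LoachAckland2017, BlancLewin2015] -/
@[route_item "route-AtomisticToContinuum-NashClassCertificates", crux]
def PeriodicGivenLayered : Prop :=
  ∀ x : (N : ℕ) → (Fin N → EuclideanSpace ℝ (Fin 3)), (∀ N, Literature.MathematicalPhysics.StatisticalMechanics.IsGroundState Literature.MathematicalPhysics.StatisticalMechanics.lennardJones (x N)) → (∃ a : ℝ, 47 / 50 ≤ a ∧ a ≤ 1 ∧ ∀ R ε : ℝ, 0 < ε → ∃ᶠ N in Filter.atTop, ∃ (A : EuclideanSpace ℝ (Fin 3) →ₗᵢ[ℝ] EuclideanSpace ℝ (Fin 3)) (t : EuclideanSpace ℝ (Fin 3)) (s : ℤ → ℤ) (z : ℤ → ℝ), Literature.MathematicalPhysics.StatisticalMechanics.IsHaggSeq s ∧ (∀ m : ℤ, 39 / 50 * a ≤ z (m + 1) - z m ∧ z (m + 1) - z m ≤ 17 / 20 * a) ∧ let S : Set (EuclideanSpace ℝ (Fin 3)) := {p | ∃ m i j : ℤ, p = A (((i : ℝ) • Literature.MathematicalPhysics.StatisticalMechanics.triangularVec₁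 a) + ((j : ℝ) • Literature.MathematicalPhysics.StatisticalMechanics.triangularVec₂ a) + ((Literature.MathematicalPhysics.StatisticalMechanics.haggLabel s m : ℝ) • Literature.MathematicalPhysics.StatisticalMechanics.barlowOffset a) + (z m • Literature.MathematicalPhysics.StatisticalMechanics.layerNormal 1))}; (∀ p ∈ S, ‖p‖ ≤ R → ∃ i : Fin N, dist (x N i + t) p ≤ ε) ∧ (∀ i : Fin N, ‖x N i + t‖ ≤ R → ∃ p ∈ S, dist (x N i + t) p ≤ ε)) → ∃ P : Literature.MathematicalPhysics.StatisticalMechanics.PeriodicConfiguration 3, ∀ R ε : ℝ, 0 < ε → ∃ᶠ N in Filter.atTop, ∃ t : EuclideanSpace ℝ (Fin 3), (∀ s ∈ P.points, ‖s‖ ≤ R → ∃ i : Fin N, dist (x N i + t) s ≤ ε) ∧ (∀ i : Fin N, ‖x N i + t‖ ≤ R → ∃ s ∈ P.points, dist (x N i + t) s ≤ ε)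

-- `PeriodicGivenLayered` holds: proved by `Summit.AtomisticToContinuum.Crystallization.Theorems.NashPeriodicGivenLayered.periodicGivenLayered_proof` @ 61c8b112ea51 (its module imports this route file, so no `_holds` link can be stated here).

/-- item stmt-AtomisticToContinuum-16828 · crux · rank 9 · closed · proved by Summit.AtomisticToContinuum.Crystallization.Theorems.LayeredWindowsLocal.nashHullBridge_proof @ 9b7af699d8a1 (prover) · by planner
why it might fail: Only bookkeeping of the port: the landed reduction hullBridge_of_layeredGluing is stated for the all-configuration antecedents; re-running it needs the Nash property threaded through its ground-state instantiation, nothing quantitative.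
sources: BlancLewin2015, HalesDSP2012, FrieseckeJamesMuller2002
[crux] BRIDGE ON THE NASH CLASS (port of the PROVED HullBridge stmt-15147 =
Theorems.HullBridgeExact.hullBridge_proof, whose proof applies its two antecedents to ground states
only): NashTwoShellGap → NashNearField → every sequence of LJ ground states has layered windows at
every scale (LayeredWindows stmt-11778 unfolded verbatim). Port: ground states are 1/3-separated
(third_le_dist_of_isGroundState) and Nash (GroundStatesAreNash), E(N) ≤ N e* + o(N)
(crysEnergyLimit_proof) gives #bad = o(N), the near field at fixed η with Ω = good particles gives
#non-η-layered good = o(N), and the landed gluing lemma PrestressSplitKorn.stub_layeredGluing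
integrates η-layered 2-balls on a margin ball exactly as in hullBridge_of_layeredGluing. [deps:
NashTwoShellGap, NashNearField] [difficulty: M] -/
@[route_item "route-AtomisticToContinuum-NashClassCertificates", crux]
def NashHullBridge : Prop :=
  NashTwoShellGap → NashNearField → (∀ x : (N : ℕ) → (Fin N → EuclideanSpace ℝ (Fin 3)), (∀ N, Literature.MathematicalPhysics.StatisticalMechanics.IsGroundState Literature.MathematicalPhysics.StatisticalMechanics.lennardJones (x N)) → ∃ a : ℝ, 47 / 50 ≤ a ∧ a ≤ 1 ∧ ∀ R ε : ℝ, 0 < ε → ∃ᶠ N in Filter.atTop, ∃ (A : EuclideanSpace ℝ (Fin 3) →ₗᵢ[ℝ] EuclideanSpace ℝ (Fin 3)) (t : EuclideanSpace ℝ (Fin 3)) (s : ℤ → ℤ) (z : ℤ → ℝ), Literature.MathematicalPhysics.StatisticalMechanics.IsHaggSeq s ∧ (∀ m : ℤ, 39 / 50 * a ≤ z (m + 1) - z m ∧ z (m + 1) - z m ≤ 17 / 20 * a) ∧ let S : Set (EuclideanSpace ℝ (Fin 3)) := {p | ∃ m i j : ℤ, p = A (((i : ℝ) • Literature.MathematicalPhysics.StatisticalMechanics.triangularVec₁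 a) + ((j : ℝ) • Literature.MathematicalPhysics.StatisticalMechanics.triangularVec₂ a) + ((Literature.MathematicalPhysics.StatisticalMechanics.haggLabel s m : ℝ) • Literature.MathematicalPhysics.StatisticalMechanics.barlowOffset a) + (z m • Literature.MathematicalPhysics.StatisticalMechanics.layerNormal 1))}; (∀ p ∈ S, ‖p‖ ≤ R → ∃ i : Fin N, dist (x N i + t) p ≤ ε) ∧ (∀ i : Fin N, ‖x N i + t‖ ≤ R → ∃ p ∈ S, dist (x N i + t) p ≤ ε))

-- `NashHullBridge` holds: proved by `Summit.AtomisticToContinuum.Crystallization.Theorems.LayeredWindowsLocal.nashHullBridge_proof` @ 9b7af699d8a1 (its module imports this route file, so no `_holds` link can be stated here).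

/-- item stmt-AtomisticToContinuum-11778 · support · rank 9 · open · by planner
sources: HalesDSP2012, BlancLewin2015
[crux] LAYERED WINDOWS (card item H2 "layering of one limit"; the genuinely 3-D crux): for every
sequence of LJ ground states x^N there is an in-layer spacing a ∈ [47/50, 1] such that for every R
and ε > 0, frequently in N, there are a linear isometry A, a translation t, a Hägg word s (IsHaggSeq
s) and layer heights z : ℤ → ℝ with all increments z(m+1) − z(m) ∈ [39a/50, 17a/20] (box B of route
PoissonBesselStacking, so its typed LjRegistryDomination stmt-3063 applies verbatim) such that x^N +
t is two-way ε-matched on B(0,R) with the rigid image under A of the layered set S = { i·u(a) +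
j·v(a) + L_s(m)·w(a) + z(m)·e₃ } (triangular layers of spacing a, consecutive layers in distinct
hole positions coded by haggLabel s, FREE interlayer spacings, so faulted and polytypic stackings
are admitted; one window per scale infinitely often, nothing for all but o(N) particles). By
compactness of [47/50,1], O(3) and the word/spacing spaces, "∃ a" outside the (R, ε) quantifiers is
equivalent to choosing a per window. [difficulty: XL] -/
@[route_item "route-AtomisticToContinuum-NashClassCertificates"]
def LayeredWindows : Prop :=
  ∀ x : (N : ℕ) → (Fin N → EuclideanSpace ℝ (Fin 3)), (∀ N, Literature.MathematicalPhysics.StatisticalMechanics.IsGroundState Literature.MathematicalPhysics.StatisticalMechanics.lennardJones (x N)) → ∃ a : ℝ, 47 / 50 ≤ a ∧ a ≤ 1 ∧ ∀ R ε : ℝ, 0 < ε → ∃ᶠ N in Filter.atTop, ∃ (A : EuclideanSpace ℝ (Fin 3) →ₗᵢ[ℝ] EuclideanSpace ℝ (Fin 3)) (t : EuclideanSpace ℝ (Fin 3)) (s : ℤ → ℤ) (z : ℤ → ℝ), Literature.MathematicalPhysics.StatisticalMechanics.IsHaggSeq s ∧ (∀ m : ℤ, 39 / 50 * a ≤ z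 (m + 1) - z m ∧ z (m + 1) - z m ≤ 17 / 20 * a) ∧ let S : Set (EuclideanSpace ℝ (Fin 3)) := {p | ∃ m i j : ℤ, p = A (((i : ℝ) • Literature.MathematicalPhysics.StatisticalMechanics.triangularVec₁ a) + ((j : ℝ) • Literature.MathematicalPhysics.StatisticalMechanics.triangularVec₂ a) + ((Literature.MathematicalPhysics.StatisticalMechanics.haggLabel s m : ℝ) • Literature.MathematicalPhysics.StatisticalMechanics.barlowOffset a) + (z m • Literature.MathematicalPhysics.StatisticalMechanics.layerNormal 1))}; (∀ p ∈ S, ‖p‖ ≤ R → ∃ i : Fin N, dist (x N i + t) p ≤ ε) ∧ (∀ i : Fin N, ‖x N i + t‖ ≤ R → ∃ p ∈ S, dist (x N i + t) p ≤ ε)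

/-- item stmt-AtomisticToContinuum-16830 · support · rank 9 · closed · proved by Summit.AtomisticToContinuum.Crystallization.Theorems.LayeredWindowsLocal.stub_groundStatesAreNash (prover) · by planner
sources: BlancLewin2015, Xue1997, Blanc2004
[support] GROUND STATES ARE NASH: for every LJ ground state x of N particles in ℝ³, every i and
every point y distinct from the other particles, siteEnergy(x,i) ≤ Σ_{j≠i} V_LJ(|y − x_j|).
One-particle move (update x i y is injective, its energy is ≥ E(N) = 𝓔(x); sum_siteEnergy_update_sub
+ two_mul_interactionEnergy). PROVED sorry-free in the planner's Sketch.lean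
(groundStatesAreNash_proof); to be landed by any prover with --supports. [difficulty: provable-now] -/
@[route_item "route-AtomisticToContinuum-NashClassCertificates"]
def GroundStatesAreNash : Prop :=
  ∀ (N : ℕ) (x : Fin N → EuclideanSpace ℝ (Fin 3)), Literature.MathematicalPhysics.StatisticalMechanics.IsGroundState Literature.MathematicalPhysics.StatisticalMechanics.lennardJones x → (∀ (i : Fin N) (y : EuclideanSpace ℝ (Fin 3)), (∀ j : Fin N, j ≠ i → y ≠ x j) → Literature.MathematicalPhysics.StatisticalMechanics.siteEnergy Literature.MathematicalPhysics.StatisticalMechanics.lennardJones x i ≤ ∑ j ∈ Finset.univ.erase i, Literature.MathematicalPhysics.StatisticalMechanics.lennardJones (dist y (x j)))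

-- `GroundStatesAreNash` holds: proved by `Summit.AtomisticToContinuum.Crystallization.Theorems.LayeredWindowsLocal.stub_groundStatesAreNash` (its module imports this route file, so no `_holds` link can be stated here).

/-- item stmt-AtomisticToContinuum-3240 · support · rank 9 · open · by planner
sources: BlancLewin2015
[target] PERIODIC WINDOWS (finite form of "some local limit of translated LJ ground states has a
non-empty periodic configuration in its orbit closure"): for every sequence of Lennard-Jones ground
states x^N in ℝ³ there is one periodic configuration P such that for every R and every ε > 0,
frequently in N, some translate x^N + t is two-way ε-matched with P.points on the closed ball B(0,R)
(every site of P in the ball has a particle within ε and every particle in the ball has a site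
within ε). Equivalent to IsCrystallizing lennardJones 3 (HullCriterion + HullCriterionConverse). -/
@[route_item "route-AtomisticToContinuum-NashClassCertificates"]
def PeriodicWindows : Prop :=
  ∀ x : (N : ℕ) → (Fin N → EuclideanSpace ℝ (Fin 3)), (∀ N, Literature.MathematicalPhysics.StatisticalMechanics.IsGroundState Literature.MathematicalPhysics.StatisticalMechanics.lennardJones (x N)) → ∃ P : Literature.MathematicalPhysics.StatisticalMechanics.PeriodicConfiguration 3, ∀ R ε : ℝ, 0 < ε → ∃ᶠ N in Filter.atTop, ∃ t : EuclideanSpace ℝ (Fin 3), (∀ s ∈ P.points, ‖s‖ ≤ R → ∃ i : Fin N, dist (x N i + t) s ≤ ε) ∧ (∀ i : Fin N, ‖x N i + t‖ ≤ R → ∃ s ∈ P.points, dist (x N i + t) s ≤ ε)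

-- earlier Assembly (stmt-AtomisticToContinuum-16831, replaced 2026-08-17T01:06:29Z -> stmt-AtomisticToContinuum-17053): retired by None — NashTwoShellGap → NashNearField → NashHullBridge → PeriodicGivenLayered → WindowOptimality → _root_.Crystallization
/-- item stmt-AtomisticToContinuum-17053 · assembly · rank 1 · open · by planner
sources: BlancLewin2015, HalesDSP2012
[assembly] NashTwoShellGap → NashNearField → NashHullBridge → PeriodicGivenLayered →
WindowOptimality → Crystallization (HullCriterion 3243 and CrysEnergyLimit 0626 are PROVED tree
theorems used inside the proof, not hypotheses) -/
@[route_item "route-AtomisticToContinuum-NashClassCertificates"]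
def Assembly : Prop :=
  NashTwoShellGap → NashNearField → NashHullBridge → PeriodicGivenLayered → _root_.Crystallization

/-! D-0027 §2.1 — DECIDING THEOREM (planner-authored via `route open/edit --closes-file`; by planner-rrepair-AtomisticToContinuum-NashClass-db305149-g2-0 2026-08-17T01:06:29Z):
its hypotheses are this route's items and its conclusion the sub-problem Statement (glue_lint), and it elaborates with this file. -/

@[closes "route-AtomisticToContinuum-NashClassCertificates"] theorem closes (h_NashTwoShellGap : NashTwoShellGap) (h_NashNearField : NashNearField)
    (h_NashHullBridge : NashHullBridge) (h_PeriodicGivenLayered : PeriodicGivenLayered) :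
    _root_.Crystallization := by
  -- (1) layered windows of every sequence of ground states: the two Nash-class certificates through the ported bridge
  have hLW : LayeredWindows := h_NashHullBridge h_NashTwoShellGap h_NashNearField
  -- (2) stacking selection inside the hull (shared item, proved in tree, kept as hypothesis): layered ⇒ periodic windows
  have hPW : PeriodicWindows := fun y hy => h_PeriodicGivenLayered y hy (hLW y hy)
  -- (3) positional conjunct (ii): the hull criterion is PROVED in tree (PrestressSplitKorn.stub_hullCriterion, item 3243)
  have hpos : Literature.MathematicalPhysics.StatisticalMechanics.IsCrystallizing
      Literature.MathematicalPhysics.StatisticalMechanics.lennardJones 3 :=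
    _root_.Summit.AtomisticToContinuum.Crystallization.Theorems.PrestressSplitKorn.stub_hullCriterion hPW
  -- (4) energetic conjunct (i): ground states exist (proved Literature theorem); their periodic window P is least by the
  --     PROVED tree theorem windowOptimality_proof (item 13962), so ⨅ = e(P), and E(N)/N → e(P) by the PROVED energy
  --     limit (crysEnergyLimit_proof, item 0626)
  have hex : Literature.MathematicalPhysics.StatisticalMechanics.LennardJonesGroundStatesExist :=
    Literature.MathematicalPhysics.StatisticalMechanics.LennardJonesGroundStatesExist_holds
  obtain ⟨x, hx⟩ : ∃ x : (N : ℕ) → (Fin N → EuclideanSpace ℝ (Fin 3)), ∀ N,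
      Literature.MathematicalPhysics.StatisticalMechanics.IsGroundState
        Literature.MathematicalPhysics.StatisticalMechanics.lennardJones (x N) :=
    ⟨fun N => (hex N).choose, fun N => (hex N).choose_spec⟩
  obtain ⟨P, hP⟩ := hPW x hx
  have hleast : IsLeast (Set.range fun Q : Literature.MathematicalPhysics.StatisticalMechanics.PeriodicConfiguration 3 =>
      Q.energyPerParticle Literature.MathematicalPhysics.StatisticalMechanics.lennardJones)
      (P.energyPerParticle Literature.MathematicalPhysics.StatisticalMechanics.lennardJones) :=
    _root_.Summit.AtomisticToContinuum.Crystallization.Theorems.windowOptimality_proof x hx P hP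
  have hinf : (⨅ Q : Literature.MathematicalPhysics.StatisticalMechanics.PeriodicConfiguration 3,
      Q.energyPerParticle Literature.MathematicalPhysics.StatisticalMechanics.lennardJones) =
      P.energyPerParticle Literature.MathematicalPhysics.StatisticalMechanics.lennardJones := hleast.csInf_eq
  have hlim : Filter.Tendsto (fun N : ℕ => Literature.MathematicalPhysics.StatisticalMechanics.groundStateEnergy
      Literature.MathematicalPhysics.StatisticalMechanics.lennardJones 3 N / N) Filter.atTop
      (nhds (P.energyPerParticle Literature.MathematicalPhysics.StatisticalMechanics.lennardJones)) := by
    have h0 : Filter.Tendsto (fun N : ℕ => Literature.MathematicalPhysics.StatisticalMechanics.groundStateEnergy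
        Literature.MathematicalPhysics.StatisticalMechanics.lennardJones 3 N / N) Filter.atTop
        (nhds (⨅ Q : Literature.MathematicalPhysics.StatisticalMechanics.PeriodicConfiguration 3,
          Q.energyPerParticle Literature.MathematicalPhysics.StatisticalMechanics.lennardJones)) :=
      _root_.Summit.AtomisticToContinuum.Crystallization.Theorems.crysEnergyLimit_proof
    rw [hinf] at h0
    exact h0
  exact ⟨⟨P, hleast, hlim⟩, hpos⟩

end Summit.AtomisticToContinuum.Crystallization.Theses.NashClassCertificates
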